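import Literature.Analysis.FluidPDE.SelfSimilarEulerTrappedTrajectories
import HarnessLib

/-!
# Connecting orbits of the self-similar Lagrangian flow descend the Bernoulli function: no homoclinic
# loops, no heteroclinic cycles (Constantin–Ignatova–Vicol 2026, §3.4.3 (3.31)–(3.33))

Analysis/FluidPDE proof file (theorems only; no definitions, no named facts, no `sorry`).

Third piece of the dynamical reading of the self-similar Bernoulli transport law
`V·∇ℋ = (2γ−1)|V|²` (P. Constantin, M. Ignatova, V. Vicol, arXiv:2602.17570, (3.31); tree
`IsSelfSimilarEulerProfile.fderiv_selfSimilarBernoulli_transport`), after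
`SelfSimilarEulerClosedOrbit.lean` (closed orbits are stagnation points) and
`SelfSimilarEulerTrappedTrajectories.lean` (trapped trajectories come to rest at the nodal set `𝒩_V`).
CIV Rem. 3.6 singles out the fixed points of the self-similar Lagrangian flow `Y' = V(Y)`,
`V = γ(y − c) + U`, and their invariant manifolds; for `γ ≠ ½` the function `(2γ−1)·ℋ` INCREASES strictly
along every non-stationary trajectory, so the stagnation points are STRICTLY RANKED by `ℋ` along connections:

* `IsSelfSimilarEulerProfile.bernoulli_connecting_orbit` — if a full trajectory `Y : ℝ → ℝ³` of `V`
  converges to `za` as `t → −∞` and to `zb` as `t → +∞` and passes through one non-stagnation point, then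
  `(2γ − 1)(ℋ(zb) − ℋ(za)) > 0` (in the window `γ < ½`: `ℋ(zb) < ℋ(za)`,
  `bernoulli_lt_of_connecting_orbit_of_window`);
* `IsSelfSimilarEulerProfile.transport_eq_zero_of_homoclinic` — **no homoclinic loops**: a full
  trajectory converging to the SAME point at both ends is stationary;
* `IsSelfSimilarEulerProfile.not_heteroclinic_two_cycle` — **no heteroclinic 2-cycles** `z₁ → z₂ → z₁`
  through non-stagnation points (longer cycles die the same way: `ℋ` would have to drop around the cycle).

KILL-TEST reading for candidate refuting profiles of the crux
`NavierStokesRegularity/EulerZoomLiouville.PowerGaugeEulerLiouville` (stmt-NavierStokesRegularity-19832,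
window `γ = 1/(2+ρ) < ½`): the separatrix skeleton of `γy + U` is ACYCLIC and ordered by `ℋ`; a candidate
whose stagnation points are joined in a loop of connections is dead.  Scope: regularity is that of
`IsSelfSimilarEulerProfile`; nothing here concerns existence of profiles or Navier–Stokes.
-/

noncomputable section

open Set Filter Topology InnerProductSpace Metric
open scoped RealInnerProductSpace

namespace Literature.Analysis.FluidPDE

namespace IsSelfSimilarEulerProfile

variable {γ : ℝ} {c : EuclideanSpace ℝ (Fin 3)}
  {U : EuclideanSpace ℝ (Fin 3) → EuclideanSpace ℝ (Fin 3)} {P : EuclideanSpace ℝ (Fin 3) → ℝ}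

/-- **Connecting orbits descend `ℋ` strictly** (`γ ≠ ½`).  Let `(U, P)` be a self-similar Euler profile,
`Y : ℝ → ℝ³` a full trajectory of `V = γ(y − c) + U` with `Y(t) → z₋ = za` (`t → −∞`) and `Y(t) → z₊ = zb`
(`t → +∞`), passing through a point outside the nodal set.  Then `(2γ−1)(ℋ(zb) − ℋ(za)) > 0`: the
function `(2γ−1)ℋ∘Y` is non-decreasing with derivative `(2γ−1)²|V(Y)|²`, has limits `(2γ−1)ℋ(z∓)` at
`∓∞`, and is not constant (its derivative is positive at the non-stagnation time).
[cite: ConstantinIgnatovaVicol2026Putative, §3.4.3 eq. (3.31)–(3.33) and Rem. 3.6] -/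
theorem bernoulli_connecting_orbit (h : IsSelfSimilarEulerProfile γ c U P) (hγ : γ ≠ 1 / 2)
    {Y : ℝ → EuclideanSpace ℝ (Fin 3)} (hY : ∀ t, HasDerivAt Y (selfSimilarTransport γ c U (Y t)) t)
    {za zb : EuclideanSpace ℝ (Fin 3)} (hbot : Tendsto Y atBot (𝓝 za)) (htop : Tendsto Y atTop (𝓝 zb))
    {t₀ : ℝ} (ht₀ : Y t₀ ∉ selfSimilarNodalSet γ c U) :
    0 < (2 * γ - 1) * (selfSimilarBernoulli γ c U P zb - selfSimilarBernoulli γ c U P za) := by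
  have hY' : ∀ t, HasDerivAt Y ((1 : ℝ) • selfSimilarTransport γ c U (Y t)) t := fun t => by
    simpa using hY t
  -- `G = (2γ−1) ℋ∘Y`, its derivative and monotonicity
  have hGd : ∀ t, HasDerivAt (fun s => (2 * γ - 1) * selfSimilarBernoulli γ c U P (Y s))
      ((2 * γ - 1) ^ 2 * ‖selfSimilarTransport γ c U (Y t)‖ ^ 2) t := by
    intro t
    have h1 := (h.hasDerivAt_bernoulli_comp hY' t).const_mul (2 * γ - 1)
    exact h1.congr_deriv (by ring)
  have hGdiff : Differentiable ℝ fun s => (2 * γ - 1) * selfSimilarBernoulli γ c U P (Y s) :=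
    fun t => (hGd t).differentiableAt
  have hmono : Monotone fun s => (2 * γ - 1) * selfSimilarBernoulli γ c U P (Y s) :=
    monotone_of_deriv_nonneg hGdiff fun t => by rw [(hGd t).deriv]; positivity
  -- limits at `±∞`
  have hHc : Continuous (selfSimilarBernoulli γ c U P) := (contDiff_selfSimilarBernoulli h).continuous
  have hlimtop : Tendsto (fun s => (2 * γ - 1) * selfSimilarBernoulli γ c U P (Y s)) atTop
      (𝓝 ((2 * γ - 1) * selfSimilarBernoulli γ c U P zb)) :=
    ((hHc.tendsto zb).comp htop).const_mul _
  have hlimbot : Tendsto (fun s => (2 * γ - 1) * selfSimilarBernoulli γ c U P (Y s)) atBot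
      (𝓝 ((2 * γ - 1) * selfSimilarBernoulli γ c U P za)) :=
    ((hHc.tendsto za).comp hbot).const_mul _
  have hle : ∀ t, (2 * γ - 1) * selfSimilarBernoulli γ c U P (Y t) ≤ (2 * γ - 1) * selfSimilarBernoulli γ c U P zb :=
    fun t => hmono.ge_of_tendsto hlimtop t
  have hge : ∀ t, (2 * γ - 1) * selfSimilarBernoulli γ c U P za ≤ (2 * γ - 1) * selfSimilarBernoulli γ c U P (Y t) :=
    fun t => hmono.le_of_tendsto hlimbot t
  -- not constant: otherwise the derivative at `t₀` would vanish
  have hlt : (2 * γ - 1) * selfSimilarBernoulli γ c U P za < (2 * γ - 1) * selfSimilarBernoulli γ c U P zb := by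
    by_contra hcon
    push Not at hcon
    have hconst : ∀ t, (2 * γ - 1) * selfSimilarBernoulli γ c U P (Y t) =
        (2 * γ - 1) * selfSimilarBernoulli γ c U P zb :=
      fun t => le_antisymm (hle t) (hcon.trans (hge t))
    have hD0 : HasDerivAt (fun s => (2 * γ - 1) * selfSimilarBernoulli γ c U P (Y s)) 0 t₀ := by
      have : (fun s => (2 * γ - 1) * selfSimilarBernoulli γ c U P (Y s)) =
          fun _ => (2 * γ - 1) * selfSimilarBernoulli γ c U P zb := funext hconst
      rw [this]
      exact hasDerivAt_const t₀ _
    have huniq := (hGd t₀).unique hD0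
    have h2 : (2 * γ - 1) ^ 2 ≠ 0 := pow_ne_zero 2 (by intro h0; apply hγ; linarith)
    have h3 : ‖selfSimilarTransport γ c U (Y t₀)‖ ^ 2 = 0 := by
      rcases mul_eq_zero.1 huniq with h4 | h4
      · exact absurd h4 h2
      · exact h4
    exact ht₀ (by
      rw [mem_selfSimilarNodalSet_iff, ← selfSimilarTransport_apply]
      exact norm_eq_zero.1 (pow_eq_zero_iff two_ne_zero |>.1 h3))
  linarith

/-- In the window `γ < ½`: **along a connecting orbit through a non-stagnation point `ℋ` strictly drops**,
`ℋ(zb) < ℋ(za)`. [cite: ConstantinIgnatovaVicol2026Putative, §3.4.3 eq. (3.31)–(3.33)] -/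
theorem bernoulli_lt_of_connecting_orbit_of_window (h : IsSelfSimilarEulerProfile γ c U P) (hγ : γ < 1 / 2)
    {Y : ℝ → EuclideanSpace ℝ (Fin 3)} (hY : ∀ t, HasDerivAt Y (selfSimilarTransport γ c U (Y t)) t)
    {za zb : EuclideanSpace ℝ (Fin 3)} (hbot : Tendsto Y atBot (𝓝 za)) (htop : Tendsto Y atTop (𝓝 zb))
    {t₀ : ℝ} (ht₀ : Y t₀ ∉ selfSimilarNodalSet γ c U) :
    selfSimilarBernoulli γ c U P zb < selfSimilarBernoulli γ c U P za := by
  have h1 := h.bernoulli_connecting_orbit (ne_of_lt hγ) hY hbot htop ht₀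
  have h2 : 2 * γ - 1 < 0 := by linarith
  by_contra hcon
  push Not at hcon
  have : (2 * γ - 1) * (selfSimilarBernoulli γ c U P zb - selfSimilarBernoulli γ c U P za) ≤ 0 :=
    mul_nonpos_of_nonpos_of_nonneg h2.le (sub_nonneg.2 hcon)
  linarith

/-- **No homoclinic loops** (`γ ≠ ½`): a full trajectory of `V` converging to the same point `z` at both
ends is stationary (every point of it is a stagnation point).
[cite: ConstantinIgnatovaVicol2026Putative, §3.4.3 eq. (3.33), Rem. 3.6] -/
theorem transport_eq_zero_of_homoclinic (h : IsSelfSimilarEulerProfile γ c U P) (hγ : γ ≠ 1 / 2)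
    {Y : ℝ → EuclideanSpace ℝ (Fin 3)} (hY : ∀ t, HasDerivAt Y (selfSimilarTransport γ c U (Y t)) t)
    {z : EuclideanSpace ℝ (Fin 3)} (hbot : Tendsto Y atBot (𝓝 z)) (htop : Tendsto Y atTop (𝓝 z)) :
    ∀ t, selfSimilarTransport γ c U (Y t) = 0 := by
  intro t
  by_contra hne
  have ht : Y t ∉ selfSimilarNodalSet γ c U := by
    rwa [mem_selfSimilarNodalSet_iff, ← selfSimilarTransport_apply]
  have h1 := h.bernoulli_connecting_orbit hγ hY hbot htop ht
  simp at h1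

/-- **No heteroclinic 2-cycles** (`γ ≠ ½`): there are no two trajectories of `V` through non-stagnation
points, one from `z₁` to `z₂` and one from `z₂` back to `z₁`.
[cite: ConstantinIgnatovaVicol2026Putative, §3.4.3 eq. (3.33), Rem. 3.6] -/
theorem not_heteroclinic_two_cycle (h : IsSelfSimilarEulerProfile γ c U P) (hγ : γ ≠ 1 / 2)
    {Y₁ Y₂ : ℝ → EuclideanSpace ℝ (Fin 3)}
    (hY₁ : ∀ t, HasDerivAt Y₁ (selfSimilarTransport γ c U (Y₁ t)) t)
    (hY₂ : ∀ t, HasDerivAt Y₂ (selfSimilarTransport γ c U (Y₂ t)) t)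
    {z₁ z₂ : EuclideanSpace ℝ (Fin 3)}
    (h₁bot : Tendsto Y₁ atBot (𝓝 z₁)) (h₁top : Tendsto Y₁ atTop (𝓝 z₂))
    (h₂bot : Tendsto Y₂ atBot (𝓝 z₂)) (h₂top : Tendsto Y₂ atTop (𝓝 z₁))
    {t₁ t₂ : ℝ} (ht₁ : Y₁ t₁ ∉ selfSimilarNodalSet γ c U) (ht₂ : Y₂ t₂ ∉ selfSimilarNodalSet γ c U) :
    False := by
  have e₁ := h.bernoulli_connecting_orbit hγ hY₁ h₁bot h₁top ht₁
  have e₂ := h.bernoulli_connecting_orbit hγ hY₂ h₂bot h₂top ht₂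
  linarith

end IsSelfSimilarEulerProfile

end Literature.Analysis.FluidPDE

end
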